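import Summits.CriticalPhenomena.Ising3DConformalLimit.Theses.EnergyNotSigmaSquared
import Summits.CriticalPhenomena.Ising3DConformalLimit.Theorems.GapForcesFarMerging.Negative.SoftVerdicts
import Summits.CriticalPhenomena.Ising3DConformalLimit.Theorems.GapForcesFarMerging.Negative.NotRP
import Literature.Probability.LatticeModels.SourcedDoubleCurrentsSwitching
import Literature.Probability.LatticeModels.CurrentsPartialMonotonicity
import Literature.Probability.LatticeModels.CriticalTwoPointBounds
import Literature.Probability.Percolation.ConstrainedClusters

/-!
# Line `screening-form-lemma-a1` — checked skeleton for crux `GapForcesFarMerging`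
# (item stmt-CriticalPhenomena-4468, route `EnergyNotSigmaSquared`, rank 2)

Crux (by name): `Summit.CriticalPhenomena.Ising3DConformalLimit.Theses.EnergyNotSigmaSquared.GapForcesFarMerging`
`= EnergyGapPowerLaw → FarMergingShape cc2 (criticalCorr 3 4)` (`Negative.SoftShapes.crux_iff`, `Iff.rfl`).

## The lever (idea card `Ideas/screening-form-lemma-a1.md`, ideator 2, round 1; TRIAGE-r1-{1,2,3})

INTEGRATE THE SECOND STRAND OUT. By the freeze-the-cluster identity ADC21 Lemma A.1 (tree, PROVED:
`Current.tsum_epairWeight_eq_tsum_mul_offRatio`) the two-current avoidance probability that GAP controls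
is an expected SCREENING RATIO across ONE random set,
`P^{ox}⊗P^{ab}[o ↮ a] = E^{ox,∅}[𝟙[a,b ∉ C] · S_{ab}(C)]`, `C = C_{n₁+n₂}(o)` the DUPLICATED cluster
(exact one-point law `G(o,u)G(u,x)/G(o,x)`, two-point law ≤ Prop. A.3 — both tree theorems), tested against
ONE deterministic, Griffiths-antitone functional `S_{ab}(T) = ⟨σ_aσ_b⟩_{Λ∖T}/⟨σ_aσ_b⟩_Λ ∈ [0,1]`. By the
restricted switching lemma (ADS15 Lemma 2.2, tree `ecurrentSumIn_empty_mul_ecurrentSum_pair`) `S_{ab}(T)`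
is itself the probability that a FRESH probe strand `a → b`, dressed by a vacuum living in `Λ∖T`, avoids `T`:
every residual statement of the line is about ONE current against a DETERMINISTIC obstacle, where three
engines are available — (H) Paley–Zygmund HITTING lower bounds from the exact densities (`stub_hittingBound`,
provable now), (E) first-moment ESCAPE bounds, (M) MONOTONICITY in the obstacle (Griffiths
`Current.offRatio_pair_mul_le`; Camia–Jiang–Newman `CamiaJiangNewman2023_thm1_two`).

## The line (7 registered stubs; `line_closes` composes their STATEMENTS sorry-free and
`GapForcesFarMerging_of` concludes the crux BY NAME from the stubs; no `sorry` outside `stub_*`)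

```
GAP ─S1→ OnePinchGap ─S2→ OnePinchScreeningDecay ─S4(+Floors)→ RootOpacityIO ─S6(+H)→ FarScreeningIO ─S7→ FarMerging
                       S3 : HittingLowerBound ─S5→ Floors          S3 ─────────────┘
```
* S1 `stub_onePinchGap` (M, provable now; RP halving shared with the `rp-*` lines): GAP ⇒ the one-pinch
  truncation `⟨σ₀σ_{e₂} ; σ_{(2m,m,0)}σ_{(2m,-m,0)}⟩ ≤ C(2m)^{-κ/2}G(2me₁)²` for all `m ≥ 1`.
* S2 `stub_screeningDecay` (L, provable now; THE CARD'S FIRST LEMMA `ScreeningIdentity` in action):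
  correlation form ⇒ MEAN-SCREENING form along the doubling far scales, in the box, `n → ∞` last.
* S3 `stub_hittingBound` (M, provable now; engine (H)): finite graphs, couplings `K ≥ 0` (so every depleted
  domain is covered): `P^{xy,∅}[C(x) ∩ T ≠ ∅] ≥ (Σ_{s∈T}G(x,s)G(s,y))²/(G(x,y)·Σ_{s,t∈T}B(s,t))` un-normalised.
* S4 `stub_rootOpacity` (M/L, provable now): antitone octave ladder of the explored cluster + ROOT FINITE
  ENERGY + the counting of gen-1 Disproof §7 (`density_of_prod_le_two_pow`) + doubling-window abundance:
  decay ∧ floors ⇒ a windowed OPAQUE root octave, infinitely often.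
* S5 `stub_floors` (L/XL, open; (S)-type): per-octave and bulk FLOORS of the ladder (quasi-multiplicativity
  from below: one octave of duplicated cluster, resp. the un-pinched bulk, never costs more than a bounded
  factor of tilted mean screening) — the printed missing input `m_k ≤ 1-δ` of `density_of_prod_le_two_pow`.
* S6 `stub_farScreening` (XL, open, HARDEST): an opaque windowed octave ⇒ a FIXED injective shape is
  screened by a definite fraction along infinitely many dilations: SEPARATION TIGHTNESS of the tilted
  configuration at the octave (via (H)+(E)), one-explorer UN-TILTING (D), depleted/sourced two-point
  comparability at the windowed scale (H_depl), antitonicity (M) and a finite-shape pigeonhole.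
* S7 `stub_farMerging` (M, provable now): far screening ≤ 1-c IS merging ≥ c (Lemma A.1 at the far
  quadruple, exactly) and ADC21 (3.11) in the box + limits: `FarMergingShape cc2 (criticalCorr 3 4)`.

## Disproof used (`Cruxes/GapForcesFarMerging/Disproof.lean` v10; landed `Theorems/…/Negative/*`, imported)

* `gapForcesFarMerging_false_without_model` / `gapShape_not_determined_by_bulk` (the MODEL is load-bearing,
  the coupling of the distance-1 datum to the bulk must happen ON THE LATTICE): honoured — the line uses the
  model at `stub_floors` and `stub_farScreening` (current-level couplings of octaves / of an octave to a
  dilated shape; H = the sourced-double-current structure of `criticalCorr 3`), at `stub_hittingBound`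
  (exact densities) and at `stub_onePinchGap` (reflection positivity, outside the package by
  `familyA_not_rpCauchySchwarz`); no stub passes through a scaling limit.
* `oneEndedGapForcesFarMerging_false_without_model`: the residual after S1 is not soft — agreed; S2–S6 are
  statements about `sourcedDoubleCurrentLaw` / depleted `isingTwoPoint`, not package consequences.
* gen-1 `cruxWithoutKappaPos_iff` (`0 < κ` load-bearing): `0 < κ'` is written into `OnePinchGap` and
  `OnePinchScreeningDecay` and consumed in S4 (a power spread over `log₂ m` octaves with floors forces a
  positive DENSITY of opaque octaves; an `o(1)` gap forces nothing).
* gen-1 §7 `io_ge_of_prod_le_two_pow` / `density_of_prod_le_two_pow` / `io_ge_needs_lt_one`: S4's counting IS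
  this bookkeeping; its floor hypothesis is the separate stub S5 (named, typed, not assumed inside S4).
* gen-1 §5 `farMergingFor_criticalCorr_iff_merge`, `farMerging_const_le_two`: S7 is their finite-volume
  screening form (it outputs `c ≤ 2`). §6 `gapHyp_unsat_without_ne_zero`: S1 applies GAP at `x = 2me₁ ≠ 0`.
No stub is an instance of a landed Negative lemma (those refute only "without model" transfers and the
`κ = 0` / `x = 0` degenerations).
-/

noncomputable section

namespace Summit.CriticalPhenomena.Ising3DConformalLimit.Cruxes.GapForcesFarMerging.ScreeningFormLemmaA1

open scoped symmDiff ENNReal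
open MeasureTheory Filter Finset
open Literature.Probability.LatticeModels Literature.Probability.Percolation
open Summit.CriticalPhenomena.Ising3DConformalLimit.Theses.EnergyNotSigmaSquared
open Summit.CriticalPhenomena.Ising3DConformalLimit.Theorems.GapForcesFarMerging.Negative (cc2 FarMergingShape)

/-! ## Lattice vocabulary (the one-pinch geometry of the `rp-*` lines, verbatim) -/

/-- `e₁ = (1,0,0)`: the mirror / far direction. [folklore] -/
abbrev e₁ : Site 3 := Pi.single 0 1
/-- `e₂ = (0,1,0)`: the direction of the energy bond `{0,e₂}` of GAP (route file: `Pi.single 1 1`). [folklore] -/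
abbrev e₂ : Site 3 := Pi.single 1 1
/-- `e₃ = (0,0,1)`: the transverse direction (escape rays in the root finite-energy step of S4). [folklore] -/
abbrev e₃ : Site 3 := Pi.single 2 1

/-- Truncated pair–pair correlation `⟨σ_aσ_b ; σ_cσ_d⟩_{β_c(3)}` of the critical state. [folklore] -/
def pairCov (a b c d : Site 3) : ℝ :=
  criticalCorr 3 4 ![a, b, c, d] - criticalCorr 3 2 ![a, b] * criticalCorr 3 2 ![c, d]

/-- The far point `xR m = 2m·e₁` (GAP is applied at `x = xR m`; `‖xR m‖ = 2m`). [folklore] -/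
def xR (m : ℕ) : Site 3 := Pi.single 0 (2 * (m : ℤ))
/-- Far source of the duplicated strand: `up m = (2m, m, 0)`. [folklore] -/
def up (m : ℕ) : Site 3 := xR m + Pi.single 1 (m : ℤ)
/-- Far end of the probe pair: `dn m = (2m, -m, 0)` (`‖up m - dn m‖ = 2m`: the far pinch is OPEN). [folklore] -/
def dn (m : ℕ) : Site 3 := xR m - Pi.single 1 (m : ℤ)

/-! ## Screening vocabulary (finite volume `Λ_n = box 3 n`, `β = β_c(3)`, free boundary condition) -/

/-- The depleted box two-point function `⟨σ_aσ_b⟩_{Λ_n ∖ T}` at `β_c(3)`: free boundary condition on the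
region `Λ_n ∖ T`, which deletes exactly the nearest-neighbour bonds meeting `T` (the restricted state of
ADC21 Lemma A.1; `T = ∅` gives `⟨σ_aσ_b⟩⁰_{Λ_n}`). [cite: AizenmanDuminilCopinAnnals2021, Appendix A, Lemma A.1] -/
def boxTwoPoint (n : ℕ) (T : Finset (Site 3)) (a b : Site 3) : ℝ :=
  isingTwoPoint (zdGraph 3) (box 3 n \ T) (criticalBeta 3) 0 .free a b

/-- SCREENING RATIO of the obstacle `T` for the probe pair `(a,b)` in `Λ_n`:
`S⁽ⁿ⁾_{ab}(T) = ⟨σ_aσ_b⟩_{Λ_n∖T}/⟨σ_aσ_b⟩_{Λ_n} ∈ [0,1]`, antitone in `T` (Griffiths II); by restricted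
switching it is the probability that the fresh probe strand `a → b` dressed by a vacuum in `Λ_n ∖ T` avoids
`T`. [cite: AizenmanDuminilCopinSidoraviciusCMP2015, Lemma 2.2] -/
def screening (n : ℕ) (T : Finset (Site 3)) (a b : Site 3) : ℝ :=
  boxTwoPoint n T a b / boxTwoPoint n ∅ a b

open Classical in
/-- The cluster of `o` EXPLORED INSIDE `Λ_r`: vertices of `Λ_r` joined to `o` by open bonds of `ω` with both
endpoints in `Λ_r` (non-decreasing in `r`; the whole cluster once `Λ_r` carries the trace). [cite: AizenmanDuminilCopinAnnals2021, §6.2] -/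
def innerCluster (r : ℕ) (o : Site 3) (ω : BondConfig (Site 3)) : Finset (Site 3) :=
  (box 3 r).filter fun v => v ∈ openClusterIn (withinGraph (zdGraph 3) (↑(box 3 r) : Set (Site 3))) ω o

open Classical in
/-- The screening functional of the explored duplicated cluster, `𝟙[a,b ∉ C(o)] · S⁽ⁿ⁾_{ab}(C_r(o))` (zero as
soon as a probe point is swallowed by the FULL cluster); pointwise antitone in `r`. [cite: AizenmanDuminilCopinAnnals2021, Appendix A, Lemma A.1] -/
def screenWeight (n r : ℕ) (o a b : Site 3) (ω : BondConfig (Site 3)) : ℝ :=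
  if a ∈ openCluster ω o ∨ b ∈ openCluster ω o then 0 else screening n (innerCluster r o ω) a b

/-- MEAN SCREENING `𝔼^{ox,∅}_{Λ_n,β_c}[𝟙[a,b ∉ C(o)]·S⁽ⁿ⁾_{ab}(C_r(o))]` under the box law of the trace of the
sourced pair `∂n₁ = {o} ∆ {x}`, `∂n₂ = ∅` (a finitely supported push-forward, so the integral is a finite
sum). For `r = n` (full cluster) Lemma A.1 makes it EQUAL to the two-current avoidance probability
`P^{ox}_{Λ_n}⊗P^{ab}_{Λ_n}[o ↮ a]`. [cite: AizenmanDuminilCopinAnnals2021, Appendix A, Lemma A.1] -/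
def meanScreening (n r : ℕ) (o x a b : Site 3) : ℝ :=
  ∫ ω, screenWeight n r o a b ω ∂(sourcedDoubleCurrentLaw 3 n (criticalBeta 3) ({o} ∆ {x}) ∅)

/-- THE ONE-PINCH SCREENING LADDER `A⁽ⁿ⁾(r; m)`: duplicated strand `0 → up m`, explored inside `Λ_r`, probed
by the pair `(e₂, dn m)` — one adjacent pinch `(0,e₂)` at the root, far ends `up m, dn m` un-pinched.
`r ↦ A(r;m)` is antitone; `A(n;m)` is the full one-pinch avoidance probability. [folklore] -/
def pinchScreen (n r m : ℕ) : ℝ := meanScreening n r 0 (up m) e₂ (dn m)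

/-! ## Currencies of the line -/

/-- (C1) ONE-PINCH GAP, correlation form, exponent `κ' > 0` written in (gen-1 Disproof
`cruxWithoutKappaPos_iff`), all scales: `⟨σ₀σ_{e₂} ; σ_{up m}σ_{dn m}⟩ ≤ C(2m)^{-κ'}⟨σ₀σ_{2me₁}⟩²`, `m ≥ 1`.
GAP gives it with `κ' = κ/2` (RP halving; literally `SinglePinchLaw` of line `rp-unpinch-single-passage`). [cite: FILS1978, Thm. 2.1] -/
def OnePinchGap : Prop :=
  ∃ κ' C : ℝ, 0 < κ' ∧ ∀ m : ℕ, 1 ≤ m →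
    pairCov 0 e₂ (up m) (dn m) ≤ C * (2 * (m : ℝ)) ^ (-κ') * criticalTwoPoint 3 (xR m) ^ 2

/-- (C2) ONE-PINCH SCREENING DECAY: for infinitely many far scales `m` (the doubling scales of
`G(·e₁)`), eventually in the box size, the full one-pinch mean screening is `≤ C m^{-κ}`, `κ > 0`: the
duplicated strand of `(0, up m)` screens its adjacent probe `e₂` from `dn m` polynomially. [cite: AizenmanDuminilCopinAnnals2021, eq. (3.7) and Lemma A.1] -/
def OnePinchScreeningDecay : Prop :=
  ∃ κ C : ℝ, 0 < κ ∧ ∃ᶠ m : ℕ in atTop, ∀ᶠ n : ℕ in atTop, pinchScreen n n m ≤ C * (m : ℝ) ^ (-κ)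

/-- DOUBLING WINDOW at octave `k` with constant `θ`: `G(2^{j+1}e₁) ≥ θ·G(2^je₁)` for `|j - k| ≤ 3`
(`G = criticalTwoPoint 3`); with MMS folding this is ADC21's regularity (P1) on `Λ_{2^{k+3}}∖Λ_{2^{k-3}}`.
Since `∏_{j<J}G(2^{j+1}e₁)/G(2^je₁) ≥ c·4^{-J}` (`criticalTwoPoint_bounds_holds`), octaves WITHOUT a
`θ`-window have upper density `≤ 7 log 4 / log(1/θ)`. [cite: AizenmanDuminilCopinAnnals2021, Def. 5.11 (P1)] -/
def DoublingWindow (θ : ℝ) (k : ℕ) : Prop :=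
  ∀ j : ℕ, k ≤ j + 3 → j ≤ k + 3 →
    θ * criticalTwoPoint 3 (((2 : ℤ) ^ j) • e₁) ≤ criticalTwoPoint 3 (((2 : ℤ) ^ (j + 1)) • e₁)

/-- (C3) FLOORS of the ladder (quasi-multiplicativity FROM BELOW; the printed missing input `m_k ≤ 1-δ` of
gen-1 Disproof `density_of_prod_le_two_pow`, here a typed currency): (octave floor) one more octave of
explored duplicated cluster costs at most a factor `δ` of tilted mean screening, uniformly in the octave
`j ≥ j₀`, the far scale `m ≥ 2^{j+4}` and large `n`; (bulk floor) from radius `2^k ≍ m/8` to the full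
cluster costs at most a factor `δ` (the far pinch is open: `‖up m - dn m‖ = 2m`). [cite: Lawler1991, Ch. 3–5] -/
def Floors : Prop :=
  ∃ δ : ℝ, 0 < δ ∧
    (∀ᶠ j : ℕ in atTop, ∀ m : ℕ, 2 ^ (j + 4) ≤ m →
      ∀ᶠ n : ℕ in atTop, δ * pinchScreen n (2 ^ j) m ≤ pinchScreen n (2 ^ (j + 1)) m) ∧
    (∀ᶠ k : ℕ in atTop, ∀ m : ℕ, 2 ^ (k + 3) ≤ m → m < 2 ^ (k + 4) →
      ∀ᶠ n : ℕ in atTop, δ * pinchScreen n (2 ^ k) m ≤ pinchScreen n n m)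

/-- (C4) OPAQUE ROOT OCTAVES, WINDOWED, INFINITELY OFTEN: there are `c, θ > 0` such that for infinitely
many octaves `k` — each inside a `θ`-doubling window — some far scale `m ≥ 2^{k+3}` has, for infinitely many
box sizes, a relative screening drop `≥ c` across the octave `Λ_{2^{k+1}}∖Λ_{2^k}` of the explored cluster:
`0 < A(2^k;m)` and `A(2^{k+1};m) ≤ (1-c)·A(2^k;m)` — i.e. under the screening tilt the fresh dressed probe
living in `Λ_n ∖ C_{2^k}` is CUT by the annulus piece `C_{2^{k+1}} ∖ C_{2^k}` with probability `≥ c`. [folklore] -/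
def RootOpacityIO : Prop :=
  ∃ c θ : ℝ, 0 < c ∧ 0 < θ ∧ ∃ᶠ k : ℕ in atTop, DoublingWindow θ k ∧ ∃ m : ℕ, 2 ^ (k + 3) ≤ m ∧
    ∃ᶠ n : ℕ in atTop, 0 < pinchScreen n (2 ^ k) m ∧
      pinchScreen n (2 ^ (k + 1)) m ≤ (1 - c) * pinchScreen n (2 ^ k) m

/-- (C5) FAR SCREENING ALONG DILATIONS OF ONE SHAPE: some injective lattice quadruple `y` and `c > 0` such
that for infinitely many `L`, for infinitely many box sizes, the full duplicated cluster of `(Ly₀, Ly₁)`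
screens the far pair `(Ly₂, Ly₃)` by a definite fraction: mean screening `≤ 1 - c`. [cite: AizenmanCMP1982, Prop. 5.3] -/
def FarScreeningIO : Prop :=
  ∃ c : ℝ, 0 < c ∧ ∃ y : Fin 4 → Site 3, Function.Injective y ∧ ∀ L₀ : ℕ, ∃ L : ℕ, L₀ ≤ L ∧
    ∃ᶠ n : ℕ in atTop,
      meanScreening n n ((L : ℤ) • y 0) ((L : ℤ) • y 1) ((L : ℤ) • y 2) ((L : ℤ) • y 3) ≤ 1 - c

/-- (H) THE HITTING ENGINE — a Paley–Zygmund capacity lower bound for the duplicated cluster against a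
DETERMINISTIC obstacle, finite graphs, couplings `K ≥ 0` (so every depleted domain `Λ ∖ T` is the case
`K = koff`): with `Z[A] = ecurrentSum K A`, `C(x) = C_{n₁+n₂}(x)` under the pair weights `1{∂n₁={x,y}}1{∂n₂=∅}ww`
and `B(s,t) = Z[xs]Z[st]Z[ty] + Z[xt]Z[ts]Z[sy]`,
`(Σ_{s∈T} Z[xs]Z[sy])² · Z[∅] ≤ (Σ_{s,t∈T} B(s,t)) · Σ 1{∂n₁={x,y}}1{∂n₂=∅} w w 𝟙[C(x) ∩ T ≠ ∅]`,
i.e. `P^{xy,∅}[C(x) ∩ T ≠ ∅] ≥ (Σ_{s∈T}G(x,s)G(s,y))² / (G(x,y)·Σ_{s,t∈T}B(s,t))` — first moment by the exact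
one-point density (`tsum_epairWeight_mul_indicator_mem_cluster`), second moment by Prop. A.3
(`Current.ecurrentSum_empty_mul_tsum_double_conn_le`), Cauchy–Schwarz
(`Current.tsum_mul_sq_le_tsum_indicator_mul_tsum_sq`). [cite: AizenmanDuminilCopinAnnals2021, Appendix A, Prop. A.3 and Lemma 4.4] -/
def HittingLowerBound : Prop :=
  ∀ (V : Type) [Fintype V] [DecidableEq V] (G : SimpleGraph V) [DecidableRel G.Adj]
    (K : G.edgeFinset → ℝ), (∀ e, 0 ≤ K e) → ∀ (x y : V) (T : Finset V),
    (∑ s ∈ T, ecurrentSum K ({x} ∆ {s}) * ecurrentSum K ({s} ∆ {y})) ^ 2 * ecurrentSum K ∅ ≤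
      (∑ s ∈ T, ∑ t ∈ T,
          (ecurrentSum K ({x} ∆ {s}) * ecurrentSum K ({s} ∆ {t}) * ecurrentSum K ({t} ∆ {y}) +
            ecurrentSum K ({x} ∆ {t}) * ecurrentSum K ({t} ∆ {s}) * ecurrentSum K ({s} ∆ {y}))) *
        ∑' p : Current G × Current G,
          epairWeight K ({x} ∆ {y}) ∅ p * (if Disjoint T ((p.1 + p.2).cluster x) then 0 else 1)

/-! ## The seven registered stubs -/

/-- **S1 — GAP un-pinched (RP halving), size M, provable now.** Intended proof (every ingredient a tree
theorem; literally `gapGivesSinglePinch` of line `rp-unpinch-single-passage` from its stubs 1–2): reflection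
positivity through the site plane `{u₀ = m}` (`isingTorus_reflectionPositive_sites_holds`, engine
`isingMeasure_univ_free_reflectionPositive`, passed to the unique critical state
`hasUniqueGibbsMeasure_criticalBeta_holds`, box limits `criticalCorr_wellDefined_holds`) and
`rp_cauchySchwarz_holds` with `F = σ₀σ_{e₂} - ⟨·⟩`, `G = σ_{me₂}σ_{-me₂} - ⟨·⟩` give the `2×2` Gram minor
`⟨ε₀ ; σ_{up}σ_{dn}⟩² ≤ ⟨ε₀ ; ε_{2me₁}⟩ · ⟨σ_{me₂}σ_{-me₂} ; σ_{up}σ_{dn}⟩`; the first factor is GAP at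
`x = 2me₁ ≠ 0`; the second is `≤ 2G(2me₁)²` (Lebowitz `criticalUrsellFour_nonpos` + Messager–Miracle-Solé
`messager_miracleSole_holds` / `twoPointPlus_le_of_mul_supNorm_le` + `criticalCorr_two_pair`); square root.
GAP is consumed here and only here. [cite: FILS1978, Thm. 2.1] -/
theorem stub_onePinchGap : EnergyGapPowerLaw → OnePinchGap := by
  sorry

/-- **S2 — the screening form (the card's FIRST LEMMA in action), size L, provable now.** Intended proof:
(i) in the box `Λ_n`, the switching line of item 4472 `EnergyFactorisation`
(`ursellFour_eq_doubleCurrent_holds`, `isingCorr_free_box_mul_eq`, `connectedFour_free_box_eq'`):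
`⟨σ₀σ_{e₂}σ_{up}σ_{dn}⟩ₙ - ⟨σ₀σ_{e₂}⟩ₙ⟨σ_{up}σ_{dn}⟩ₙ = Gₙ(0,up)Gₙ(e₂,dn)·A^{par}ₙ + Gₙ(0,dn)Gₙ(e₂,up)·A^{cross}ₙ`,
both terms `≥ 0`; (ii) `ScreeningIdentity` = Lemma A.1 `Current.tsum_epairWeight_eq_tsum_mul_offRatio` with
`A = {0}∆{up}`, `B = {e₂}∆{dn}`, `F = 𝟙[e₂ ∉ C]` (`hloc` by `Current.cluster_add_congr_right`, `hvan` by the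
source parity `e₂ ∈ C ⇔ dn ∈ C`, `Current.disjoint_cluster_of_sources_eq_right`) and the dictionary
`sourcedDoubleCurrentLaw ↔ epairWeight`, `Current.offRatio ↔ boxTwoPoint` (`sourcedDoubleCurrentLaw_apply`,
`isingTwoPoint_free_box_eq_boxGraph`, `isingTwoPoint_free_eq_currentSum_div`; the push-forward of a finitely
supported measure under the measurable `sourcedTrace` is a finite sum of Diracs and `BondConfig (Site 3)` has
measurable singletons, so `meanScreening` is a genuine finite sum): `A^{par}ₙ = pinchScreen n n m`;
(iii) `n → ∞` (`criticalCorr_wellDefined_holds`): `limsupₙ pinchScreen n n m ≤ ⟨ε₀;σ_{up}σ_{dn}⟩/(G(0,up)G(e₂,dn))`;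
(iv) Messager–Miracle-Solé in the sup norm (`twoPointPlus_le_of_mul_supNorm_le`: `3‖v‖ ≤ ‖w‖ ⇒ G(w) ≤ G(v)`;
`‖up m‖ = ‖dn m - e₂‖ = 2m` for `m ≥ 1`, translation invariance `criticalCorr_two_pair`) and along the axis (`messager_miracleSole_holds`) give
`G(0,up m), G(e₂,dn m) ≥ G(6me₁) ≥ G(8me₁)`, so `A ≤ C(2m)^{-κ'}·(G(2me₁)/G(8me₁))²`; (v) at the DOUBLING
scales `2m = 2^i` with `G(2^{i+2}e₁) ≥ G(2^ie₁)/64` — infinitely many, since otherwise `G(2^{i₀+2k}e₁) <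
64^{-k}G(2^{i₀}e₁)`, contradicting `c‖x‖⁻² ≤ G` (`criticalTwoPoint_bounds_holds`) — the squared ratio is
`≤ 64²`. No ADC regularity is needed. [cite: AizenmanDuminilCopinAnnals2021, Appendix A, Lemma A.1] -/
theorem stub_screeningDecay : OnePinchGap → OnePinchScreeningDecay := by
  sorry

/-- **S3 — the hitting engine (H), size M, provable now** (statement and proof route in the docstring of
`HittingLowerBound`; the registered base case of the (H)/(E)/(M) engine that S5 and S6 run in depleted and
multi-source clothing with the same general-`K` proofs). [cite: AizenmanDuminilCopinAnnals2021, Appendix A, Prop. A.3 and Lemma 4.4] -/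
theorem stub_hittingBound : HittingLowerBound := by
  sorry

/-- **S4 — root finite energy + the Disproof-§7 counting: decay ∧ floors ⇒ a windowed opaque root octave,
i.o. Size M/L, provable now.** Intended proof: (a) ANTITONICITY `A(2^{j+1};m) ≤ A(2^j;m)` pointwise in `ω`
(`innerCluster` grows with the radius: `openClusterIn_mono_graph`; `screening` is antitone in the obstacle:
GKS II for the free state in its couplings / `Current.offRatio_pair_mul_le`); (b) ROOT FINITE ENERGY: for
each `j₀` an `η(j₀) > 0` with `A(2^{j₀};m) ≥ η` for all `m ≥ 2^{j₀+3}`, eventually in `n` — on the event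
"`n₁+n₂` vanishes on the bonds touching the ray `e₂ + [0,2^{j₀}+1]·e₃`" (probability `≥ p(j₀)` uniformly in
the far source `up m` and in `n`: `P[n ≡ 0 on E₀] = (⟨σ_A⟩_{Λ∖E₀}/⟨σ_A⟩_Λ)·(Z_{Λ∖E₀}[∅]/Z_Λ[∅])` for each of the
two independent currents, `CurrentInsertion.lean`/`IsingFiniteEnergy.lean`-type local surgery, and
`P[dn m ∈ C] = G(0,dn)G(dn,up)/G(0,up) ≤ C/m`) one has `e₂ ∉ C`, the ray escapes `Λ_{2^{j₀}}` off `C_{2^{j₀}}`, and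
`S_{e₂,dn}(C_{2^{j₀}}) ≥ η'(j₀)` (a LOCAL depletion leaving an undeleted escape chain changes a two-point
function to a far point by a bounded factor: GKS II along the chain + FK/Ising finite energy outside
`Λ_{2^{j₀}+2}`); (c) COUNTING (gen-1 Disproof `density_of_prod_le_two_pow`): along the decay scales `m`, with
`2^{K+3} ≤ m < 2^{K+4}`, `C m^{-κ} ≥ A(n;m) ≥ δ·A(2^K;m) = δ·A(2^{j₀};m)·∏_{j₀≤j<K} r_{j+1}` with every ratio
`r ∈ [δ, 1]` forces `#{j < K : r_{j+1} ≤ 1-c} ≥ ρ₀K - b`, `ρ₀ = ρ₀(κ,δ,c) > 0` for `c < 1 - 2^{-κ}`;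
(d) WINDOWS: `θ`-doubling windows miss at most a `7 log 4/log(1/θ)`-fraction of octaves
(`criticalTwoPoint_bounds_holds`), so for `θ = θ(ρ₀)` an opaque windowed octave `j ≥ ρ₀K/4` exists;
pigeonhole over `n` (finitely many subsets of `[j₀,K)`) gives `∃ᶠ n`, and `K → ∞` along the decay scales
gives `∃ᶠ k`. [folklore] -/
theorem stub_rootOpacity : OnePinchScreeningDecay → Floors → RootOpacityIO := by
  sorry

/-- **S5 — FLOORS (open, size L/XL; the (S)-type input).** Intended proof: restricted switching
(`ecurrentSumIn_empty_mul_ecurrentSum_pair`, ADS15 Lemma 2.2) reads `1 - r_{j+1}` as the tilted probability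
that the FRESH probe strand `e₂ → dn m` living in `Λ_n ∖ C_{2^j}` (dressed in `Λ_n ∖ C_{2^{j+1}}`) is cut by the
annulus piece `C_{2^{j+1}} ∖ C_{2^j}`; a floor `r_{j+1} ≥ δ` follows from (i) SEPARATION at radius `2^j` under
the screening tilt — with tilted probability `≥ 1/2` the probe's passage density through `∂Λ_{2^j}` (exact:
`⟨σ_{e₂}σ_u⟩_{Λ∖C}⟨σ_uσ_{dn}⟩_{Λ∖C}/⟨σ_{e₂}σ_{dn}⟩_{Λ∖C}`) puts mass `≥ 1/2` at distance `≥ ρ2^j` from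
`C_{2^j}`, because closeness WITHOUT touching over consecutive octaves is exponentially unlikely: a duplicated
cluster piece of size `≍ r` at distance `≤ ρr` is hit with probability `≥ p₀(ρ)` per octave by (H)
(`HittingLowerBound`, scale-free: `(Σ G G)²/(G Σ B) = O(1)` at a windowed scale) — and (ii) EXTENSION:
ρ-separated objects extend through one octave (resp. to the un-pinched far ends `up m`, `dn m`, `2m` apart)
inside disjoint tubes with probability `≥ δ(ρ)`: tube confinement of the outer duplicated cluster under the
one-explorer conditional law (domain Markov `Current.tsum_pair_eq_sum_clusterSet` + additive mixing for the
O(1)-probability tube event, Panis arXiv:2406.15243 Thm 2.4 / ADC21 Thm 6.4 suffice HERE because the event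
is order one) and a tube lower bound for depleted sourced correlations (GKS II chains, finite energy).
Why it might fail: the separation-under-tilt statement for a sourced duplicated cluster on `ℤ³` is the
analogue of Lawler's Brownian / Kozma–Shiraishi's 3D-LERW separation lemma and is unproved; the bet is that
it needs only ONE explorer against a frozen obstacle and the exact densities. [cite: Lawler1991, Ch. 3–5] -/
theorem stub_floors : HittingLowerBound → Floors := by
  sorry

/-- **S6 — HARDEST: an opaque windowed root octave forces far screening of a fixed shape (open, XL).**
From `RootOpacityIO` (octave `k` in a `θ`-window, far scale `m ≥ 2^{k+3}`, tilted cut-probability `≥ c` of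
the fresh depleted probe by the annulus piece, frequently in `n`) to `FarScreeningIO`. Intended proof:
(i) SEPARATION TIGHTNESS at radius `2^k` under the tilt (as in S5 (i), from (H)+(E)): the cut event is
carried, up to `c/2`, by configurations whose probe passage and cluster crossing of `∂Λ_{2^k}` are
`ρ2^k`-apart, `ρ = ρ(c)`; (ii) UN-TILT (D, ONE explorer): by domain Markov for the pair `(n₁,n₂)` explored
inside `Λ_{2^k}` (`Current.tsum_pair_eq_sum_clusterSet`; chain rule `BackboneChainRule*.lean`) the law of the
annulus piece given the inside depends on it only through the frontier sources/flux, and for O(1)-probability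
events at ONE octave it is comparable, up to constants, to that of a fresh duplicated cluster sourced on the
lattice near the crossing point (tightness of the number of crossings: ADC21 §6.2, printed for `d = 4`;
far-source insensitivity `m ≥ 2^{k+3}` arbitrary: Panis arXiv:2406.15243 Thm 3.1, IIC of sourced currents in
`d ≥ 3`); (iii) RELOCATION (H_depl): move the four sources to points of the grid `2^{k-j₀}ℤ³` — a two-sided
Harnack comparability of sourced / depleted two-point functions `⟨σ_uσ_v⟩_{Λ∖T}` under moving `u` at scale
`dist(u,T) ≍ ρ2^k`; its deterministic part (ADC (P1) on `Λ_{2^{k+3}}∖Λ_{2^{k-3}}`) is the `DoublingWindow`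
conjunct + MMS folding, the gradient part (P2) is `TwoPointGradientEstimate.lean` (DCP25 (1.11)) — open at
an arbitrary windowed scale on `ℤ³` (ADC21 Def. 5.11/Thm 5.12 are `d = 4` in tree: `RegularScales*.lean`);
(iv) (M) antitonicity of `S` in the obstacle (a sub-obstacle comparable to the annulus piece suffices to
screen) and (H) for the relocated fresh cluster; (v) PIGEONHOLE over the finite family of injective shapes in
`([-8·2^{j₀}, 8·2^{j₀}] ∩ ℤ)³ˣ⁴`, dilation `L = 2^{k-j₀}`, along the infinitely many `k`. Why it might fail:
(D) and (H_depl) for SOURCED/DEPLETED currents on `ℤ³` are the crux's recorded missing technology; the bet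
of this line is that after integrating the second strand out only ONE-object comparabilities at ONE octave
where the cut probability is already ORDER ONE are needed — never joint conditioning of a merged pair on
boundary flux, never an additive mixing theorem under a rare event. [cite: AizenmanDuminilCopinAnnals2021, §6.2 and Thm 5.12] -/
theorem stub_farScreening : HittingLowerBound → RootOpacityIO → FarScreeningIO := by
  sorry

/-- **S7 — far screening IS far merging (exact), back to spins; size M, provable now.** Intended proof: in
the box, Lemma A.1 with `A = {Ly₀}∆{Ly₁}`, `B = {Ly₂}∆{Ly₃}`, `F = 𝟙[Ly₂ ∉ C]` (parity `Ly₂ ∈ C ⇔ Ly₃ ∈ C`)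
and the dictionary of S2 give `P^{Ly₀Ly₁,Ly₂Ly₃}_{Λ_n}[Ly₀ ↔ Ly₂] = 1 - meanScreening n n (Ly₀) (Ly₁) (Ly₂) (Ly₃) ≥ c`;
ADC21 (3.11) in the box (`connectedFour_free_box_eq`, proved) gives `U₄^{Λ_n}(Ly) = -2GₙGₙ·Pₙ`; the limits
`tendsto_connectedFour_box_criticalBeta`, `criticalCorr_wellDefined_holds` and `G(Ly₀,Ly₁)G(Ly₂,Ly₃) > 0`
(`criticalTwoPoint_bounds_holds`) turn "`≥ c` frequently in `n`" into `U₄(Ly) ≤ -2c·GG` (and `2c ≤ 2`,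
gen-1 Disproof `farMerging_const_le_two`). [cite: AizenmanDuminilCopinAnnals2021, eq. (3.11) and Lemma A.1] -/
theorem stub_farMerging : FarScreeningIO → FarMergingShape cc2 (criticalCorr 3 4) := by
  sorry

/-! ## Composition: the stubs conclude the crux BY NAME -/

/-- The logic of the line, sorry-free: the seven stub STATEMENTS compose to
`EnergyGapPowerLaw → FarMergingShape cc2 (criticalCorr 3 4)`, the crux unfolded one step
(`Negative.SoftShapes.crux_iff`, `Iff.rfl`). [folklore] -/
theorem line_closes
    (h₁ : EnergyGapPowerLaw → OnePinchGap)
    (h₂ : OnePinchGap → OnePinchScreeningDecay)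
    (h₃ : HittingLowerBound)
    (h₄ : OnePinchScreeningDecay → Floors → RootOpacityIO)
    (h₅ : HittingLowerBound → Floors)
    (h₆ : HittingLowerBound → RootOpacityIO → FarScreeningIO)
    (h₇ : FarScreeningIO → FarMergingShape cc2 (criticalCorr 3 4)) :
    EnergyGapPowerLaw → FarMergingShape cc2 (criticalCorr 3 4) :=
  fun hgap => h₇ (h₆ h₃ (h₄ (h₂ (h₁ hgap)) (h₅ h₃)))

/-- **The skeleton theorem**: the crux BY NAME from the seven declared stubs (the only `sorry`s of the
file live inside `stub_*`; kernel-checked against the route decl by `δ`-unfolding). [folklore] -/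
theorem GapForcesFarMerging_of :
    Summit.CriticalPhenomena.Ising3DConformalLimit.Theses.EnergyNotSigmaSquared.GapForcesFarMerging :=
  line_closes stub_onePinchGap stub_screeningDecay stub_hittingBound stub_rootOpacity stub_floors
    stub_farScreening stub_farMerging

/-! ## Sanity lemmas (sorry-free) -/

/-- The crux is literally `EnergyGapPowerLaw → FarMergingShape cc2 (criticalCorr 3 4)`. [folklore] -/
theorem crux_iff' :
    Summit.CriticalPhenomena.Ising3DConformalLimit.Theses.EnergyNotSigmaSquared.GapForcesFarMerging ↔
      (EnergyGapPowerLaw → FarMergingShape cc2 (criticalCorr 3 4)) := Iff.rfl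

/-- The ladder at the full radius is the full one-pinch mean screening (definitional). [folklore] -/
theorem pinchScreen_full (n m : ℕ) : pinchScreen n n m = meanScreening n n 0 (up m) e₂ (dn m) := rfl

/-- `‖xR m‖ = 2m` (GAP is applied at a non-zero point for `m ≥ 1`, cf. Disproof §6). [folklore] -/
theorem norm_xR (m : ℕ) : ‖xR m‖ = 2 * (m : ℝ) := by
  rw [xR, Pi.norm_single, Int.norm_eq_abs]
  push_cast
  rw [abs_of_nonneg (by positivity)]

/-- `xR m ≠ 0` for `m ≥ 1`. [folklore] -/
theorem xR_ne_zero {m : ℕ} (hm : 1 ≤ m) : xR m ≠ 0 := by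
  intro h
  have := congrFun h 0
  simp [xR] at this
  omega

set_option linter.unnecessarySeqFocus false in
/-- The far ends are `2m` apart in sup norm: the far pinch is open. [folklore] -/
theorem up_sub_dn (m : ℕ) : up m - dn m = Pi.single 1 (2 * (m : ℤ)) := by
  ext i; fin_cases i <;> simp [up, dn, xR] <;> ring

end Summit.CriticalPhenomena.Ising3DConformalLimit.Cruxes.GapForcesFarMerging.ScreeningFormLemmaA1

end
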